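import Summits.HodgeConjecture.CorCM.Census.MultiFieldWeilDefect
import Summits.HodgeConjecture.CorCM.SexticOcticWeilFrameTransfer
import HarnessLib

/-!
# COR-CM — MULTI-FIELD WEIL, part 3: the slots `(k, K_1, …, K_r)`, the model map, the REALISED TUPLES of permutations, FRAME TRANSFER
# (no Galois hypothesis), and the divisor lines of conjugate pairs — for ANY number of CM fields of ANY degrees sharing `k`

Cell `pub-hodgecm2` (COR-CM), seat b30 gen 28 (2026-08-23); count-neutral own lane MULTI-FIELD WEIL ENGINE, over the kernel census
`Census/MultiFieldWeil{,Defect}`.  Theorems, plus THREE bookkeeping definitions (the slot map `mfSlots`, the model map `toPtG`, the finset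
`realisedTuples` of tuples of permutations of the conjugate pairs of the `K_m` induced by ONE automorphism of `ℂ` fixing `τ`); no named fact,
no `sorry`.  The generic form of gen 26ʼs `CorCM/SexticOcticWeilFrameTransfer.lean` (whose size-free frame lemmas §1 are used BY NAME).
SETTING: index type `I`, fields `Kf`, slots `mfSlots i₀ is = Fin.cons i₀ is : Fin (r+1) → I`; realisations `A j ⊨ (Kf (mfSlots i₀ is j); Φ j)`:
`E = A 0 ⊨ (k; {τ})` (`hΨ`), `B_m = A m.succ ⊨ (K_m; Φ m.succ)` with `s ∈ Φ m.succ ⟺ (e m s).2 = [(e m s).1 ∈ P m]` (`hΦ`) for frames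
`e m : Hom(K_m, ℂ) ≃ Fin (n m) × Bool` reading the sign over `τ` (`he_sign`) and commuting with conjugation (`he_conj`).

* §0 `mfSlots`, `toPtG`, `sigma_casesG`, conjugation on the index set;
* §1 `realisedTuples e τ`, `mem_realisedTuples`, `mul_mem_`/`pow_mem_realisedTuples`, **`exists_mem_realisedTuples_of_comp_tau_eq`** (every automorphism fixing `τ` realises a
  tuple — gen 26ʼs size-free `exists_perm_of_comp_tau_eq_fin`);
* §2 `toPtG_injective`, `toPtG_conj_smul`, `comp_mem_iff_toPtG_mem_phiG`, **`modelBalancedG_of_isGaloisBalancedAlg`** — FRAME TRANSFER for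
  every slot map `κ : Fin N → Fin (r+1)`, NO Galois hypothesis;
* §3 **`weightClassesAlg_le_algebraicClasses_of_pairG`** — two points of a weight of `⨁_j A(κ j)` over conjugate model points span a divisor
  line (Lefschetz `(1,1)` on `Y = ⨁ A`, lifted along `κ` by the distribution lemma).
HONEST FRAMING: nothing about the Hodge conjecture is concluded here; `HC_CM` is not asserted.
[cite: Pohlmann1968, Thm 1] [cite: GaoUllmo2025, Thm 3.1 (3.2)] [cite: Shimura1998, §18.2 Lemma (i)] [cite: Gordon1999HodgeAVSurvey, 9.2.2]

## References
* [Pohlmann1968] Ann. of Math. 88 (1968), Thm 1.  [GaoUllmo2025] J. Inst. Math. Jussieu 25 (2025), Thm 3.1 (3.2).  [Shimura1998]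
  G. Shimura, *Abelian varieties with CM and modular functions*, §18.2 Lemma (i).  [Gordon1999HodgeAVSurvey] CRM Monogr. 10 (1999), 9.2.2.
  [Milne2020HodgeClassesAV] J. S. Milne, arXiv:2010.08857, 1.2 (a), Thm. 1.
-/

noncomputable section

open CategoryTheory CategoryTheory.Limits NumberField

namespace Summit.HodgeConjecture.CorCM.MultiFieldWeil

open Literature.AlgebraicGeometry Literature.AlgebraicGeometry.Motives Literature.AlgebraicGeometry.HodgeTheory
open Literature.AlgebraicGeometry.ComplexMultiplication (IsCMTypeRealisation)
open Literature.AlgebraicGeometry.Pohlmann1968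
open Literature.AlgebraicTopology.SingularHomology
open Literature.NumberTheory.ComplexMultiplication
open Summit.HodgeConjecture.CorCM.Census.MultiFieldWeil
open Summit.HodgeConjecture.CorCM.SexticOcticWeil (exists_perm_of_comp_tau_eq_fin apply_comp_eq_of_realises_fin)
open Summit.HodgeConjecture.CorCM.OcticCurveFourfold (comp_injective comp_conjugate)
open Summit.HodgeConjecture.CorCM.CMWeights (weightClassesAlg_comp_le_algebraicClasses_of_injOn)
open Summit.HodgeConjecture.CorCM.PairWeights
open Summit.HodgeConjecture.CorCM.DihedralSexticPairCurvePowers (ncard_sep_eq_card_filter)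

open scoped Classical Pointwise

/-! ## §0 The slots and the model map -/
section Defs

variable {I : Type} {r : ℕ}

/-- The fields of the `r + 1` slots of `E × B_1 × ⋯ × B_r`: `(i₀; is)` — `Fin.cons`, so that the values are DEFINITIONALLY `i₀` at `0` and
`is m` at `m.succ`. [folklore] -/
def mfSlots (i₀ : I) (is : Fin r → I) : Fin (r + 1) → I := Fin.cons i₀ is

variable {Kf : I → Type} [∀ i, Field (Kf i)] {i₀ : I} {is : Fin r → I} {n : Fin r → ℕ}

/-- **The model map** `Hom(k × K_1 × ⋯ × K_r, ℂ) → PtG n`: `(0, σ) ↦ inl [σ = τ]`, `(m+1, s) ↦ inr ⟨m, e m s⟩`. [folklore] -/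
def toPtG (e : ∀ m : Fin r, (Kf (is m) →+* ℂ) ≃ Fin (n m) × Bool) (τ : Kf i₀ →+* ℂ) :
    ((j : Fin (r + 1)) × (Kf (mfSlots i₀ is j) →+* ℂ)) → PtG n := fun x =>
  Fin.cases (motive := fun j => (Kf (mfSlots i₀ is j) →+* ℂ) → PtG n)
    (fun σ => Sum.inl (decide (σ = τ))) (fun m s => Sum.inr ⟨m, e m s⟩) x.1 x.2

variable (e : ∀ m : Fin r, (Kf (is m) →+* ℂ) ≃ Fin (n m) × Bool) (τ : Kf i₀ →+* ℂ)

/-- `toPtG` on the curve slot. [folklore] -/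
@[simp] theorem toPtG_zero (σ : Kf i₀ →+* ℂ) : toPtG e τ ⟨0, σ⟩ = Sum.inl (decide (σ = τ)) := rfl

/-- `toPtG` on the field slots. [folklore] -/
@[simp] theorem toPtG_succ (m : Fin r) (s : Kf (is m) →+* ℂ) : toPtG e τ ⟨m.succ, s⟩ = Sum.inr ⟨m, e m s⟩ := rfl

/-- Every point of the index set is `(0, σ)` or `(m+1, s)`. [folklore] -/
theorem sigma_casesG (x : (j : Fin (r + 1)) × (Kf (mfSlots i₀ is j) →+* ℂ)) :
    (∃ σ : Kf i₀ →+* ℂ, x = ⟨0, σ⟩) ∨ ∃ (m : Fin r) (s : Kf (is m) →+* ℂ), x = ⟨m.succ, s⟩ := by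
  obtain ⟨j, s⟩ := x
  refine Fin.cases ?_ (fun m => ?_) j s
  · exact fun σ => Or.inl ⟨σ, rfl⟩
  · exact fun s => Or.inr ⟨m, s, rfl⟩

/-- The slot of a point over a curve label is `0`. [folklore] -/
theorem fst_eq_zero_of_toPtG_eq_inl {x : (j : Fin (r + 1)) × (Kf (mfSlots i₀ is j) →+* ℂ)} {b : Bool}
    (hx : toPtG e τ x = Sum.inl b) : x.1 = 0 := by
  rcases sigma_casesG x with ⟨σ, rfl⟩ | ⟨m, s, rfl⟩
  · rfl
  · rw [toPtG_succ] at hx; exact absurd hx Sum.inr_ne_inl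

/-- The slot of a point over a label of the field `m` is `m + 1`. [folklore] -/
theorem fst_eq_succ_of_toPtG_eq_inr {x : (j : Fin (r + 1)) × (Kf (mfSlots i₀ is j) →+* ℂ)} {m : Fin r} {q : Fin (n m) × Bool}
    (hx : toPtG e τ x = Sum.inr ⟨m, q⟩) : x.1 = m.succ := by
  rcases sigma_casesG x with ⟨σ, rfl⟩ | ⟨m', s, rfl⟩
  · rw [toPtG_zero] at hx; exact absurd hx Sum.inl_ne_inr
  · rw [toPtG_succ, Sum.inr.injEq] at hx
    exact congrArg Fin.succ (congrArg Sigma.fst hx)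

/-- Complex conjugation on the curve slot of the index set. [folklore] -/
theorem conj_smul_zeroG (σ : Kf i₀ →+* ℂ) :
    (starRingAut : ℂ ≃+* ℂ) • (⟨0, σ⟩ : (j : Fin (r + 1)) × (Kf (mfSlots i₀ is j) →+* ℂ)) =
      ⟨0, (ComplexEmbedding.conjugate σ : Kf i₀ →+* ℂ)⟩ :=
  Sigma.ext rfl (heq_of_eq (RingHom.ext fun _ => rfl))

/-- Complex conjugation on the field slots of the index set. [folklore] -/
theorem conj_smul_succG (m : Fin r) (s : Kf (is m) →+* ℂ) :
    (starRingAut : ℂ ≃+* ℂ) • (⟨m.succ, s⟩ : (j : Fin (r + 1)) × (Kf (mfSlots i₀ is j) →+* ℂ)) =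
      ⟨m.succ, (ComplexEmbedding.conjugate s : Kf (is m) →+* ℂ)⟩ :=
  Sigma.ext rfl (heq_of_eq (RingHom.ext fun _ => rfl))

end Defs

/-! ## §1 The realised tuples of permutations -/

section Realised

variable {I : Type} {r : ℕ} {Kf : I → Type} [∀ i, Field (Kf i)] {i₀ : I} {is : Fin r → I} {n : Fin r → ℕ}

/-- **The realised tuples**: the tuples `(π_m)_m` of permutations of the conjugate pairs of the `K_m` induced by ONE automorphism `ρ` of `ℂ`
fixing `τ` (`ρ ∘ (e m)⁻¹(a, true) = (e m)⁻¹(π m a, true)`).  IRREDUCIBLE (use `mem_realisedTuples`): for concrete degrees the finset is a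
large closed term whose unfolding must be prevented. [cite: Shimura1998, §18.2 Lemma (i)] -/
irreducible_def realisedTuples (e : ∀ m : Fin r, (Kf (is m) →+* ℂ) ≃ Fin (n m) × Bool) (τ : Kf i₀ →+* ℂ) : Finset (PermsG n) :=
  Finset.univ.filter fun π => ∃ ρ : ℂ ≃+* ℂ, (ρ : ℂ →+* ℂ).comp τ = τ ∧
    ∀ (m : Fin r) (a : Fin (n m)), (ρ : ℂ →+* ℂ).comp ((e m).symm (a, true)) = (e m).symm (π m a, true)

variable (e : ∀ m : Fin r, (Kf (is m) →+* ℂ) ≃ Fin (n m) × Bool) (τ : Kf i₀ →+* ℂ)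

/-- Membership in `realisedTuples e τ`. [folklore] -/
theorem mem_realisedTuples (π : PermsG n) :
    π ∈ realisedTuples e τ ↔ ∃ ρ : ℂ ≃+* ℂ, (ρ : ℂ →+* ℂ).comp τ = τ ∧
      ∀ (m : Fin r) (a : Fin (n m)), (ρ : ℂ →+* ℂ).comp ((e m).symm (a, true)) = (e m).symm (π m a, true) := by
  rw [realisedTuples_def]
  simp

/-- **The realised tuples are closed under products** (compose the automorphisms). [folklore] -/
theorem mul_mem_realisedTuples {π π' : PermsG n} (h : π ∈ realisedTuples e τ) (h' : π' ∈ realisedTuples e τ) :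
    π * π' ∈ realisedTuples e τ := by
  obtain ⟨ρ, hρτ, hρ⟩ := (mem_realisedTuples e τ π).1 h
  obtain ⟨ρ', hρτ', hρ'⟩ := (mem_realisedTuples e τ π').1 h'
  refine (mem_realisedTuples e τ _).2 ⟨ρ'.trans ρ, ?_, fun m a => ?_⟩
  · rw [RingEquiv.coe_ringHom_trans, RingHom.comp_assoc, hρτ', hρτ]
  · rw [RingEquiv.coe_ringHom_trans, RingHom.comp_assoc, hρ' m a, hρ m (π' m a), Pi.mul_apply, Equiv.Perm.mul_apply]

/-- **Closed under powers.** [folklore] -/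
theorem pow_mem_realisedTuples {π : PermsG n} (h : π ∈ realisedTuples e τ) (j : ℕ) : π ^ (j + 1) ∈ realisedTuples e τ := by
  induction j with
  | zero => rw [zero_add, pow_one]; exact h
  | succ j ih => rw [pow_succ]; exact mul_mem_realisedTuples e τ ih h

variable {e τ} {im : ∀ m : Fin r, Kf i₀ →+* Kf (is m)}
  (he_sign : ∀ (m : Fin r) (s : Kf (is m) →+* ℂ), (e m s).2 = true ↔ s.comp (im m) = τ)

include he_sign in
/-- **Every automorphism of `ℂ` fixing `τ` realises a tuple** (it permutes each `τ`-fibre: gen 26ʼs size-free `exists_perm_of_comp_tau_eq_fin`),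
which then records where `ρ` moves each embedding over `τ`. [cite: Shimura1998, §18.2 Lemma (i)] -/
theorem exists_mem_realisedTuples_of_comp_tau_eq (ρ : ℂ ≃+* ℂ) (hρ : (ρ : ℂ →+* ℂ).comp τ = τ) :
    ∃ π ∈ realisedTuples e τ, ∀ (m : Fin r) (a : Fin (n m)), (ρ : ℂ →+* ℂ).comp ((e m).symm (a, true)) = (e m).symm (π m a, true) := by
  choose π hπ using fun m => exists_perm_of_comp_tau_eq_fin (he_sign m) ρ hρ
  exact ⟨π, (mem_realisedTuples e τ π).2 ⟨ρ, hρ, hπ⟩, hπ⟩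

end Realised

/-! ## §2 Frame transfer for the products of copies, no Galois hypothesis -/

section Transfer

variable {I : Type} {r : ℕ} {Kf : I → Type} [∀ i, Field (Kf i)] {i₀ : I} {is : Fin r → I} {n : Fin r → ℕ}
  {e : ∀ m : Fin r, (Kf (is m) →+* ℂ) ≃ Fin (n m) × Bool} {τ : Kf i₀ →+* ℂ}
  (hττ : ComplexEmbedding.conjugate τ ≠ τ) (hk : ∀ σ : Kf i₀ →+* ℂ, σ = τ ∨ σ = ComplexEmbedding.conjugate τ)

include hττ hk in
/-- The model map is injective (`Hom(k, ℂ) = {τ, τ̄}`, the `e m` bijections, the slot is recorded). [folklore] -/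
theorem toPtG_injective : Function.Injective (toPtG (i₀ := i₀) e τ) := by
  intro x y hxy
  rcases sigma_casesG x with ⟨σ, rfl⟩ | ⟨m, s, rfl⟩ <;> rcases sigma_casesG y with ⟨σ', rfl⟩ | ⟨m', s', rfl⟩
  · rw [toPtG_zero, toPtG_zero, Sum.inl.injEq] at hxy
    rcases hk σ with rfl | rfl <;> rcases hk σ' with rfl | rfl
    · rfl
    · simp only [decide_true] at hxy; exact absurd (of_decide_eq_true hxy.symm) hττ
    · simp only [decide_true] at hxy; exact absurd (of_decide_eq_true hxy) hττ
    · rfl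
  · exact absurd hxy (by rw [toPtG_zero, toPtG_succ]; exact Sum.inl_ne_inr)
  · exact absurd hxy (by rw [toPtG_zero, toPtG_succ]; exact Sum.inr_ne_inl)
  · rw [toPtG_succ, toPtG_succ, Sum.inr.injEq] at hxy
    obtain ⟨rfl, h⟩ := (Sigma.mk.injEq _ _ _ _).mp hxy |> fun h => (⟨h.1, h.2⟩ : m = m' ∧ _)
    rw [heq_iff_eq] at h
    rw [(e m).injective h]

variable {im : ∀ m : Fin r, Kf i₀ →+* Kf (is m)}
  (he_sign : ∀ (m : Fin r) (s : Kf (is m) →+* ℂ), (e m s).2 = true ↔ s.comp (im m) = τ)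
  (he_conj : ∀ (m : Fin r) (s : Kf (is m) →+* ℂ), e m (ComplexEmbedding.conjugate s) = ((e m s).1, !(e m s).2))

include he_conj hττ hk in
/-- Conjugation is read in the model: `toPtG x̄ = cjG (toPtG x)`. [folklore] -/
theorem toPtG_conj_smul (x : (j : Fin (r + 1)) × (Kf (mfSlots i₀ is j) →+* ℂ)) :
    toPtG e τ ((starRingAut : ℂ ≃+* ℂ) • x) = cjG (toPtG e τ x) := by
  rcases sigma_casesG x with ⟨σ, rfl⟩ | ⟨m, s, rfl⟩
  · have key : decide (ComplexEmbedding.conjugate σ = τ) = !decide (σ = τ) := by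
      rcases hk σ with rfl | rfl
      · rw [decide_eq_false hττ]; simp
      · rw [ComplexEmbedding.involutive_conjugate, decide_eq_false hττ]; simp
    rw [conj_smul_zeroG, toPtG_zero, toPtG_zero, key, cjG_inl]
  · rw [conj_smul_succG, toPtG_succ, toPtG_succ, he_conj]
    rfl

include hττ hk in
/-- On `Hom(k, ℂ) = {τ, τ̄}`, an automorphism fixing `τ` satisfies `ρ ∘ σ = τ ⟺ σ = τ`. [folklore] -/
theorem comp_eq_tau_iff_of_comp_tau_eq (ρ : ℂ ≃+* ℂ) (hρτ : (ρ : ℂ →+* ℂ).comp τ = τ) (σ : Kf i₀ →+* ℂ) :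
    (ρ : ℂ →+* ℂ).comp σ = τ ↔ σ = τ := by
  rcases hk σ with rfl | rfl
  · exact ⟨fun _ => rfl, fun _ => hρτ⟩
  · constructor
    · intro h
      exact absurd (comp_injective (K := Kf i₀) ρ (h.trans hρτ.symm)) hττ
    · intro h
      exact absurd h hττ

variable {P : ∀ m : Fin r, Finset (Fin (n m))} {Φ : ∀ j : Fin (r + 1), CMType (Kf (mfSlots i₀ is j))}
  (hΨ : ∀ σ : Kf i₀ →+* ℂ, σ ∈ (Φ 0).1 ↔ σ = τ)
  (hΦ : ∀ (m : Fin r) (s : Kf (is m) →+* ℂ), s ∈ (Φ m.succ).1 ↔ (e m s).2 = decide ((e m s).1 ∈ P m))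

include hττ hk he_conj hΨ hΦ in
/-- **Membership read in the frames**: for a realiser `ρ` of the tuple `π` fixing `τ`, `ρ ∘ x ∈ Φ ⟺ toPtG x ∈ phiG P π` (on the curve slot
`ρ` fixes `τ`; on the field slots `ρ` keeps signs and moves the pair `a` to `π m a`). [cite: GaoUllmo2025, Thm 3.1 (3.2)]
[cite: Shimura1998, §18.2 Lemma (i)] -/
theorem comp_mem_iff_toPtG_mem_phiG [∀ i, NumberField (Kf i)] [∀ i, IsCMField (Kf i)]
    {ρ : ℂ ≃+* ℂ} {π : PermsG n} (hρτ : (ρ : ℂ →+* ℂ).comp τ = τ)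
    (hρ : ∀ (m : Fin r) (a : Fin (n m)), (ρ : ℂ →+* ℂ).comp ((e m).symm (a, true)) = (e m).symm (π m a, true))
    (x : (j : Fin (r + 1)) × (Kf (mfSlots i₀ is j) →+* ℂ)) :
    (ρ : ℂ →+* ℂ).comp x.2 ∈ (Φ x.1).1 ↔ toPtG e τ x ∈ phiG P π := by
  rcases sigma_casesG x with ⟨σ, rfl⟩ | ⟨m, s, rfl⟩
  · change (ρ : ℂ →+* ℂ).comp σ ∈ (Φ 0).1 ↔ _
    rw [hΨ, toPtG_zero, inl_mem_phiG, comp_eq_tau_iff_of_comp_tau_eq hττ hk ρ hρτ σ]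
    exact ⟨fun h => decide_eq_true h, fun h => of_decide_eq_true h⟩
  · change (ρ : ℂ →+* ℂ).comp s ∈ (Φ m.succ).1 ↔ _
    rw [hΦ, toPtG_succ, apply_comp_eq_of_realises_fin (he_conj m) ρ (hρ m) s]
    exact (inr_mem_phiG P π m _ _).symm

variable {N : ℕ} (κ : Fin N → Fin (r + 1))

include hττ hk he_conj hΨ hΦ in
/-- **FRAME TRANSFER, no Galois hypothesis**: an `Aut(ℂ)`-balanced weight of `X = ⨁_j A(κ j)` (`IsGaloisBalancedAlg` for the CM algebra
`∏_j K_{κ j}`, types `Φ (κ j)`) is a balanced configuration of the census model under EVERY realised tuple (`R = realisedTuples e τ`),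
via `v = toPtG e τ ∘ P`, `P (j, s) = (κ j, s)`. [cite: GaoUllmo2025, Thm 3.1 (3.2)] [cite: Pohlmann1968, Thm 1] -/
theorem modelBalancedG_of_isGaloisBalancedAlg [∀ i, NumberField (Kf i)] [∀ i, IsCMField (Kf i)]
    {S : Finset ((j : Fin N) × (Kf (mfSlots i₀ is (κ j)) →+* ℂ))}
    (hS : IsGaloisBalancedAlg (K := fun j => Kf (mfSlots i₀ is (κ j))) (fun j => Φ (κ j)) S) :
    ModelBalancedG P (realisedTuples e τ) (fun x => toPtG e τ ((Sigma.map κ (fun _ => id) :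
      ((j : Fin N) × (Kf (mfSlots i₀ is (κ j)) →+* ℂ)) → ((l : Fin (r + 1)) × (Kf (mfSlots i₀ is l) →+* ℂ))) x)) S := by
  intro π hπ
  beta_reduce
  obtain ⟨ρ, hρτ, hρ⟩ := (mem_realisedTuples e τ π).1 hπ
  have h := hS ρ
  rw [ncard_sep_eq_card_filter, ncard_sep_eq_card_filter] at h
  have key : ∀ x : (j : Fin N) × (Kf (mfSlots i₀ is (κ j)) →+* ℂ),
      (ρ : ℂ →+* ℂ).comp x.2 ∈ (Φ (κ x.1)).1 ↔ toPtG e τ ((Sigma.map κ (fun _ => id) :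
        ((j : Fin N) × (Kf (mfSlots i₀ is (κ j)) →+* ℂ)) → ((l : Fin (r + 1)) × (Kf (mfSlots i₀ is l) →+* ℂ))) x) ∈ phiG P π :=
    fun x => comp_mem_iff_toPtG_mem_phiG hττ hk he_conj hΨ hΦ hρτ hρ ⟨κ x.1, x.2⟩
  rw [Finset.filter_congr fun x _ => key x, Finset.filter_congr fun x _ => (key x).not] at h
  have htot := Finset.card_filter_add_card_filter_not
    (s := S) (fun x => toPtG e τ ((Sigma.map κ (fun _ => id) :
        ((j : Fin N) × (Kf (mfSlots i₀ is (κ j)) →+* ℂ)) → ((l : Fin (r + 1)) × (Kf (mfSlots i₀ is l) →+* ℂ))) x) ∈ phiG P π)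
  omega

end Transfer

/-! ## §3 Two points over conjugate model points span an algebraic (divisor) line -/

section Pairs

variable {I : Type} {r : ℕ} {Kf : I → Type} [∀ i, Field (Kf i)] [∀ i, NumberField (Kf i)] [∀ i, IsCMField (Kf i)]
  {i₀ : I} {is : Fin r → I} {n : Fin r → ℕ} {N : ℕ} (κ : Fin N → Fin (r + 1))
  {e : ∀ m : Fin r, (Kf (is m) →+* ℂ) ≃ Fin (n m) × Bool} {τ : Kf i₀ →+* ℂ}
  (hττ : ComplexEmbedding.conjugate τ ≠ τ) (hk : ∀ σ : Kf i₀ →+* ℂ, σ = τ ∨ σ = ComplexEmbedding.conjugate τ)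
  (he_conj : ∀ (m : Fin r) (s : Kf (is m) →+* ℂ), e m (ComplexEmbedding.conjugate s) = ((e m s).1, !(e m s).2))
  {A : Fin (r + 1) → AbelianVariety ℂ} {Φ : ∀ j : Fin (r + 1), CMType (Kf (mfSlots i₀ is j))}
  {ι : ∀ j, 𝓞 (Kf (mfSlots i₀ is j)) →+* End (A j)}
  {θ : ∀ j, Kf (mfSlots i₀ is j) →+* Module.End ℂ (complexBetti (A j).X 1)}
  (hA : ∀ j, IsCMTypeRealisation (Φ j) (A j) (ι j) (θ j))

include hττ hk he_conj hA in
/-- **Two points of `Y = ⨁ A` over conjugate model points form a conjugation-stable weight, so their line is algebraic** (a divisor line: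
Lefschetz `(1,1)` on the abelian variety `⨁ A`). [cite: Gordon1999HodgeAVSurvey, 9.2.2] -/
theorem weightClassesAlg_le_algebraicClasses_of_pairY {x x' : (j : Fin (r + 1)) × (Kf (mfSlots i₀ is j) →+* ℂ)}
    (hv : toPtG e τ x' = cjG (toPtG e τ x)) :
    ({x, x'} : Finset _).card = 2 * 1 ∧ weightClassesAlg A ι (2 * 1) {x, x'} ≤ algebraicClasses (⨁ A).X 1 := by
  have hinj := toPtG_injective (e := e) hττ hk (is := is)
  have hne : x ≠ x' := fun h => cjG_ne (toPtG e τ x) (by rw [← hv, h])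
  have hcard : ({x, x'} : Finset _).card = 2 * 1 := Finset.card_pair hne
  have hx' : x' = (starRingAut : ℂ ≃+* ℂ) • x := hinj (by rw [toPtG_conj_smul hττ hk he_conj, hv])
  have hx : x = (starRingAut : ℂ ≃+* ℂ) • x' := hinj (by rw [toPtG_conj_smul hττ hk he_conj, hv, cjG_cjG])
  refine ⟨hcard, weightClassesAlg_le_algebraicClasses_of_conj_smul_mem hA (m := 1) hcard fun z hz => ?_⟩
  rw [Finset.mem_insert, Finset.mem_singleton] at hz ⊢
  rcases hz with rfl | rfl
  · exact Or.inr hx'.symm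
  · exact Or.inl hx.symm

include hττ hk he_conj hA in
/-- **Two points of a weight of `X = ⨁_j A(κ j)` over conjugate model points span an algebraic (divisor) line**: the model map separates them,
so the slot projection to `Y = ⨁ A` is injective on the pair with the same images — a divisor line (§3) — lifted along `κ` (distribution
lemma). [cite: Gordon1999HodgeAVSurvey, 9.2.2] [cite: Milne2020HodgeClassesAV, 1.2 (a) and Thm. 1] -/
theorem weightClassesAlg_le_algebraicClasses_of_pairG {x x' : (j : Fin N) × (Kf (mfSlots i₀ is (κ j)) →+* ℂ)}
    (hv : toPtG e τ ((Sigma.map κ (fun _ => id) : ((j : Fin N) × (Kf (mfSlots i₀ is (κ j)) →+* ℂ)) →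
        ((l : Fin (r + 1)) × (Kf (mfSlots i₀ is l) →+* ℂ))) x') =
      cjG (toPtG e τ ((Sigma.map κ (fun _ => id) : ((j : Fin N) × (Kf (mfSlots i₀ is (κ j)) →+* ℂ)) →
        ((l : Fin (r + 1)) × (Kf (mfSlots i₀ is l) →+* ℂ))) x))) :
    ({x, x'} : Finset _).card = 2 * 1 ∧ weightClassesAlg (fun j => A (κ j)) (fun j => ι (κ j)) (2 * 1) {x, x'} ≤
      algebraicClasses (⨁ fun j => A (κ j)).X 1 := by
  set Pm : ((j : Fin N) × (Kf (mfSlots i₀ is (κ j)) →+* ℂ)) → ((l : Fin (r + 1)) × (Kf (mfSlots i₀ is l) →+* ℂ)) :=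
    Sigma.map κ (fun _ => id) with hPm
  have hne' : toPtG e τ (Pm x) ≠ toPtG e τ (Pm x') := fun h => cjG_ne (toPtG e τ (Pm x)) (by rw [← hv]; exact h.symm)
  have hne : x ≠ x' := fun h => hne' (by rw [h])
  have hcard : ({x, x'} : Finset _).card = 2 * 1 := Finset.card_pair hne
  have hPinj : Set.InjOn Pm ↑({x, x'} : Finset _) := by
    intro z hz z' hz' h
    simp only [Finset.coe_insert, Finset.coe_singleton, Set.mem_insert_iff, Set.mem_singleton_iff] at hz hz'
    rcases hz with rfl | rfl <;> rcases hz' with rfl | rfl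
    · rfl
    · exact absurd (congrArg (toPtG e τ) h) hne'
    · exact absurd (congrArg (toPtG e τ) h).symm hne'
    · rfl
  obtain ⟨-, hYalg⟩ := weightClassesAlg_le_algebraicClasses_of_pairY hττ hk he_conj hA (x := Pm x) (x' := Pm x') hv
  have himg : ({x, x'} : Finset _).image Pm = {Pm x, Pm x'} := by rw [Finset.image_insert, Finset.image_singleton]
  refine ⟨hcard, weightClassesAlg_comp_le_algebraicClasses_of_injOn (K := fun l => Kf (mfSlots i₀ is l)) hA κ hcard hPinj ?_⟩
  rw [himg]
  exact hYalg

end Pairs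

end Summit.HodgeConjecture.CorCM.MultiFieldWeil

end
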